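import Mathlib
import Summits.ResolutionOfSingularities.ResolutionOfSingularities.Theorems.WeightedInvariantLocalWeightedDropNCDirectrixCutMonomialPair
import Summits.ResolutionOfSingularities.ResolutionOfSingularities.Theorems.WeightedInvariantLocalWeightedDropSpaceCountGameInvariance
import Summits.ResolutionOfSingularities.ResolutionOfSingularities.Theorems.WeightedInvariantLocalWeightedDropSliceChart
import Summits.ResolutionOfSingularities.ResolutionOfSingularities.Theorems.WeightedInvariantLocalWeightedDropMonicLinearBlowupDoublePoint
import Summits.ResolutionOfSingularities.ResolutionOfSingularities.Theorems.WeightedInvariantLocalWeightedDropTrackCNCPayload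
import Summits.ResolutionOfSingularities.ResolutionOfSingularities.Theorems.WeightedInvariantLocalWeightedDropNCBranchPrimesSwap
import Summits.ResolutionOfSingularities.ResolutionOfSingularities.Theorems.WeightedInvariantLocalWeightedDropNCGameBWinsDefs
import Summits.ResolutionOfSingularities.ResolutionOfSingularities.Theorems.WeightedInvariantLocalWeightedDropNCResSettingStart

/-!
# `WeightedInvariant.LocalWeightedDrop`: LINE `directrix-cut`, SNC₂ — THE x₀-LIFT (1/5): RENAMING TOOLKIT, LIFT FAMILY, CHART AND SLICE COMPATIBILITIES

OURS (res-L1-w43-stub-4 g6 for the ENGINE crux `LocalWeightedDrop` stmt-ResolutionOfSingularities-8899, W′|₄ line, R₂ corner, piece LIFT of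
res-L1-w43-strat-1's `stub_pairLift` (g11 `snc2_interface_v1.lean` e57a74989d55635b); candidates, not facts; counted 0).  THE x₀-LIFT transports a
`(m+1)`-variable B-permissible decorated strategy (`TameFourTupleDrop.DBWinsTo`, res-L1-w43-lead-1 p575221) along the product structure of a pair
position `Φ^*f = u · X₀ · (X₀ + g(x₁…x_{m+1}))`: lifted moves `(Φ;Λ(Ψ), (1,w))` with `Λ(Ψ) = (X₀, rename succ ∘ Ψ)`; answers with `c₀ ≠ 0` exit by a
head drop, answers with `c₀ = 0` are pair positions over the shadow's transform, normal-crossing shadows are monomial pair positions.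

THIS FILE: order / weighted order / `X`-divisibility / substitution under an injective renaming; series without `X 0`; the lift family
`Λ(Ψ)` (substitutable, acts through `Ψ` on renamed series, determinant = det of `Ψ`, a count move); the four-variable chart and slice on renamed
series are the renamed three-variable chart and slice.
-/

set_option linter.dupNamespace false

noncomputable section

namespace Summit.ResolutionOfSingularities.ResolutionOfSingularities.Theorems

namespace TameFourTupleDrop

namespace PairLift

open MvPowerSeries Literature.AlgebraicGeometry.Resolution

variable {k : Type} [Field k] {σ τ : Type}

/-! ## Order and weighted order under an injective renaming -/

/-- The weight of a re-indexed exponent. -/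
theorem weight_mapDomain (e : σ ↪ τ) (w : τ → ℕ) (x : σ →₀ ℕ) :
    Finsupp.weight w (Finsupp.mapDomain e x) = Finsupp.weight (w ∘ e) x := by
  simp only [Finsupp.weight_apply]
  exact Finsupp.sum_mapDomain_index (h := fun i c => c • w i) (fun b => zero_smul ℕ (w b)) (fun b m₁ m₂ => add_smul m₁ m₂ (w b))

/-- **Renaming preserves the weighted order** (weights pulled back along the renaming). -/
theorem weightedOrder_rename (e : σ ↪ τ) (w : τ → ℕ) (F : MvPowerSeries σ k) :
    (rename e F).weightedOrder w = F.weightedOrder (w ∘ e) := by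
  classical
  refine le_antisymm ?_ ?_
  · refine le_weightedOrder _ fun x hx => ?_
    rw [← coeff_embDomain_rename e F x]
    refine coeff_eq_zero_of_lt_weightedOrder w ?_
    rwa [Finsupp.embDomain_eq_mapDomain, weight_mapDomain]
  · refine le_weightedOrder _ fun y hy => ?_
    by_cases hmem : y ∈ Set.range (Finsupp.mapDomain e)
    · obtain ⟨x, rfl⟩ := hmem
      rw [← Finsupp.embDomain_eq_mapDomain, coeff_embDomain_rename]
      refine coeff_eq_zero_of_lt_weightedOrder (w ∘ e) ?_
      rwa [← weight_mapDomain e w x]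
    · exact coeff_rename_eq_zero _ _ hmem

/-- **Renaming preserves the order.** -/
theorem order_rename (e : σ ↪ τ) (F : MvPowerSeries σ k) : (rename e F).order = F.order := by
  rw [order, order, weightedOrder_rename]
  rfl

/-- Renaming preserves the constant coefficient. -/
theorem constantCoeff_rename' (e : σ ↪ τ) (F : MvPowerSeries σ k) : constantCoeff (rename e F) = constantCoeff F := by
  rw [← coeff_zero_eq_constantCoeff_apply, ← coeff_zero_eq_constantCoeff_apply, ← coeff_embDomain_rename e F 0, Finsupp.embDomain_zero]

/-! ## Divisibility by a variable under renaming -/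

/-- A variable in the range divides the renamed series iff the original variable divides. -/
theorem X_dvd_rename_iff (e : σ ↪ τ) (i : σ) (F : MvPowerSeries σ k) : (X (e i) : MvPowerSeries τ k) ∣ rename e F ↔ X i ∣ F := by
  constructor
  · intro h
    have h' := map_dvd (killCompl (R := k) e) h
    rwa [killCompl_X, killCompl_rename_app] at h'
  · intro h
    have h' := map_dvd (rename (R := k) e) h
    rwa [rename_X] at h'

/-- Divisibility is reflected by an injective renaming. -/
theorem dvd_of_rename_dvd_rename (e : σ ↪ τ) {F G : MvPowerSeries σ k} (h : rename e F ∣ rename e G) : F ∣ G := by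
  have h' := map_dvd (killCompl (R := k) e) h
  rwa [killCompl_rename_app, killCompl_rename_app] at h'

/-! ## Renaming and substitution -/

/-- Substituting into a renamed series = substituting the re-indexed family. -/
theorem subst_rename [Finite σ] [Finite τ] {υ : Type} [Finite υ] (e : σ ↪ τ) {Θ : τ → MvPowerSeries υ k} (hΘ : HasSubst Θ) (F : MvPowerSeries σ k) :
    subst Θ (rename e F) = subst (Θ ∘ e) F := by
  rw [rename_eq_subst, subst_comp_subst_apply (HasSubst.X_comp _) hΘ]
  congr 1
  funext i
  simp only [Function.comp_apply, subst_X hΘ]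

/-- Renaming a substituted series = substituting the renamed family. -/
theorem rename_subst [Finite σ] [Finite τ] {υ : Type} [Finite υ] (e : τ ↪ υ) {Θ : σ → MvPowerSeries τ k} (hΘ : HasSubst Θ) (F : MvPowerSeries σ k) :
    rename e (subst Θ F) = subst (fun i => rename e (Θ i)) F := by
  rw [rename_eq_subst, subst_comp_subst_apply hΘ (HasSubst.X_comp _)]
  congr 1
  funext i
  rw [rename_eq_subst]

/-- The renamed family of a substitutable family is substitutable. -/
theorem hasSubst_rename [Finite σ] {υ : Type} [Finite υ] (e : τ ↪ υ) {Θ : σ → MvPowerSeries τ k} (hΘ : ∀ i, constantCoeff (Θ i) = 0) :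
    HasSubst (fun i => rename e (Θ i)) :=
  hasSubst_of_constantCoeff_zero fun i => by rw [constantCoeff_rename', hΘ i]

/-! ## Series without the variable `X 0` -/

/-- The exponent `cons 0 x` is the re-indexing of `x` along `Fin.succ`. -/
theorem embDomain_succEmb {n : ℕ} (x : Fin n →₀ ℕ) : Finsupp.embDomain (Fin.succEmb n) x = Finsupp.cons 0 x := by
  ext j
  refine Fin.cases ?_ (fun i => ?_) j
  · rw [Finsupp.cons_zero, Finsupp.embDomain_notin_range]
    rintro ⟨i, hi⟩
    exact Fin.succ_ne_zero i hi
  · rw [Finsupp.cons_succ, show (i.succ : Fin (n + 1)) = Fin.succEmb n i from rfl, Finsupp.embDomain_apply_self]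

/-- An exponent in the range of `Fin.succ`-re-indexing vanishes at `0`. -/
theorem mapDomain_succ_apply_zero {n : ℕ} (x : Fin n →₀ ℕ) : Finsupp.mapDomain (Fin.succEmb n) x 0 = 0 := by
  rw [← Finsupp.embDomain_eq_mapDomain, embDomain_succEmb, Finsupp.cons_zero]

/-- **A SERIES WITHOUT `X 0` IS A RENAMED SERIES IN THE OTHER VARIABLES**: `g = rename succ (killCompl succ g)`. -/
theorem rename_killCompl_of_coeff_eq_zero {n : ℕ} {g : MvPowerSeries (Fin (n + 1)) k} (hg : ∀ d : Fin (n + 1) →₀ ℕ, d 0 ≠ 0 → coeff d g = 0) :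
    rename (Fin.succEmb n) (killCompl (Fin.succEmb n) g) = g := by
  ext y
  by_cases hy : y 0 = 0
  · have hyx : y = Finsupp.embDomain (Fin.succEmb n) (Finsupp.tail y) := by
      rw [embDomain_succEmb, ← Finsupp.cons_tail y, Finsupp.tail_cons, hy]
    rw [hyx, coeff_embDomain_rename, coeff_killCompl]
  · rw [hg y hy, coeff_rename_eq_zero]
    rintro ⟨x, rfl⟩
    exact hy (mapDomain_succ_apply_zero x)

/-- The coefficients of a `Fin.succ`-renamed series away from its range vanish: no `X 0`. -/
theorem coeff_rename_succ_eq_zero {n : ℕ} (G : MvPowerSeries (Fin n) k) {d : Fin (n + 1) →₀ ℕ} (hd : d 0 ≠ 0) :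
    coeff d (rename (Fin.succEmb n) G) = 0 := by
  refine coeff_rename_eq_zero _ _ ?_
  rintro ⟨x, rfl⟩
  exact hd (mapDomain_succ_apply_zero x)

/-- `X 0` does not divide a non-zero `Fin.succ`-renamed series. -/
theorem not_X_zero_dvd_rename_succ {n : ℕ} {G : MvPowerSeries (Fin n) k} (hG : G ≠ 0) :
    ¬ (X (0 : Fin (n + 1)) : MvPowerSeries (Fin (n + 1)) k) ∣ rename (Fin.succEmb n) G := by
  intro h
  have hk := map_dvd (killCompl (R := k) (Fin.succEmb n)) h
  rw [killCompl_rename_app, killCompl_X_eq_zero (by rintro ⟨i, hi⟩; exact Fin.succ_ne_zero i hi)] at hk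
  exact hG (zero_dvd_iff.mp hk)

/-! # PART 2 — the lift family, chart and slice compatibilities -/

section LiftFam

variable {n : ℕ}

/-! ## The lift family `Λ(Ψ) = (X 0, rename succ ∘ Ψ)` -/

/-- The lift family is constant-free. -/
theorem constantCoeff_liftFam {Ψ : Fin n → MvPowerSeries (Fin n) k} (hΨ0 : ∀ j, constantCoeff (Ψ j) = 0) (l : Fin (n + 1)) :
    constantCoeff ((Fin.cons (X 0) (fun j => rename (Fin.succEmb n) (Ψ j)) : Fin (n + 1) → MvPowerSeries (Fin (n + 1)) k) l) = 0 := by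
  refine Fin.cases ?_ (fun j => ?_) l
  · rw [Fin.cons_zero, constantCoeff_X]
  · rw [Fin.cons_succ, constantCoeff_rename', hΨ0]

/-- The lift family is substitutable. -/
theorem hasSubst_liftFam {Ψ : Fin n → MvPowerSeries (Fin n) k} (hΨ0 : ∀ j, constantCoeff (Ψ j) = 0) :
    HasSubst ((Fin.cons (X 0) (fun j => rename (Fin.succEmb n) (Ψ j)) : Fin (n + 1) → MvPowerSeries (Fin (n + 1)) k)) :=
  hasSubst_of_constantCoeff_zero (constantCoeff_liftFam hΨ0)

/-- The lift family fixes `X 0`. -/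
theorem subst_liftFam_X_zero {Ψ : Fin n → MvPowerSeries (Fin n) k} (hΨ0 : ∀ j, constantCoeff (Ψ j) = 0) :
    subst ((Fin.cons (X 0) (fun j => rename (Fin.succEmb n) (Ψ j)) : Fin (n + 1) → MvPowerSeries (Fin (n + 1)) k))
      (X 0 : MvPowerSeries (Fin (n + 1)) k) = X 0 := by
  rw [subst_X (hasSubst_liftFam hΨ0)]
  exact Fin.cons_zero _ _

/-- **The lift family acts on renamed series through `Ψ`**: `Λ(Ψ)^* (rename succ F) = rename succ (Ψ^* F)`. -/
theorem subst_liftFam_rename {Ψ : Fin n → MvPowerSeries (Fin n) k} (hΨ0 : ∀ j, constantCoeff (Ψ j) = 0) (F : MvPowerSeries (Fin n) k) :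
    subst ((Fin.cons (X 0) (fun j => rename (Fin.succEmb n) (Ψ j)) : Fin (n + 1) → MvPowerSeries (Fin (n + 1)) k)) (rename (Fin.succEmb n) F) =
      rename (Fin.succEmb n) (subst Ψ F) := by
  rw [subst_rename _ (hasSubst_liftFam hΨ0), rename_subst _ (hasSubst_of_constantCoeff_zero hΨ0)]
  rfl

/-- The lift of a pair equation `u · X₀ · (X₀ + rename succ g)`. -/
theorem subst_liftFam_pair {Ψ : Fin n → MvPowerSeries (Fin n) k} (hΨ0 : ∀ j, constantCoeff (Ψ j) = 0) (u : MvPowerSeries (Fin (n + 1)) k)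
    (g : MvPowerSeries (Fin n) k) :
    subst ((Fin.cons (X 0) (fun j => rename (Fin.succEmb n) (Ψ j)) : Fin (n + 1) → MvPowerSeries (Fin (n + 1)) k))
        (u * (X 0 * (X 0 + rename (Fin.succEmb n) g))) =
      subst ((Fin.cons (X 0) (fun j => rename (Fin.succEmb n) (Ψ j)) : Fin (n + 1) → MvPowerSeries (Fin (n + 1)) k)) u *
        (X 0 * (X 0 + rename (Fin.succEmb n) (subst Ψ g))) := by
  have hΛ := hasSubst_liftFam (k := k) hΨ0
  rw [← coe_substAlgHom hΛ]
  simp only [map_mul, map_add, coe_substAlgHom]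
  rw [subst_liftFam_X_zero hΨ0, subst_liftFam_rename hΨ0]

/-! ## The linear part of the lift family -/

/-- Degree-one coefficients of a `succ`-renamed series. -/
theorem coeff_single_succ_rename (F : MvPowerSeries (Fin n) k) (j : Fin n) :
    coeff (Finsupp.single j.succ 1) (rename (Fin.succEmb n) F) = coeff (Finsupp.single j 1) F := by
  rw [show Finsupp.single (j.succ : Fin (n + 1)) 1 = Finsupp.embDomain (Fin.succEmb n) (Finsupp.single j 1) by
    rw [Finsupp.embDomain_single]; rfl, coeff_embDomain_rename]

/-- The degree-one coefficient at `X 0` of a `succ`-renamed series vanishes. -/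
theorem coeff_single_zero_rename (F : MvPowerSeries (Fin n) k) :
    coeff (Finsupp.single (0 : Fin (n + 1)) 1) (rename (Fin.succEmb n) F) = 0 :=
  coeff_rename_succ_eq_zero F (by rw [Finsupp.single_eq_same]; exact one_ne_zero)

/-- **The linear part of the lift family is `1 ⊕ lin(Ψ)`**: its determinant is that of `Ψ`. -/
theorem det_liftFam (Ψ : Fin n → MvPowerSeries (Fin n) k) :
    Matrix.det (Matrix.of fun i j => coeff (Finsupp.single j 1)
        (((Fin.cons (X 0) (fun j => rename (Fin.succEmb n) (Ψ j)) : Fin (n + 1) → MvPowerSeries (Fin (n + 1)) k)) i)) =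
      Matrix.det (Matrix.of fun i j => coeff (Finsupp.single j 1) (Ψ i)) := by
  rw [Matrix.det_succ_row_zero, Finset.sum_eq_single (0 : Fin (n + 1))]
  · rw [Fin.val_zero, pow_zero, one_mul, Matrix.of_apply, Fin.cons_zero, coeff_X, if_pos rfl, one_mul]
    congr 1
    ext i j
    rw [Matrix.submatrix_apply, Matrix.of_apply, Matrix.of_apply, Fin.succAbove_zero, Fin.cons_succ, coeff_single_succ_rename]
  · intro j _ hj
    rw [Matrix.of_apply, Fin.cons_zero, coeff_X,
      if_neg (show ¬ (Finsupp.single j 1 : Fin (n + 1) →₀ ℕ) = Finsupp.single 0 1 from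
        fun h => hj (Finsupp.single_left_injective one_ne_zero h)), mul_zero, zero_mul]
  · exact fun h => absurd (Finset.mem_univ _) h

/-- **The lift family is a count move** for the weights `(1, w)`, `w ∈ {0,1}^n`. -/
theorem isCountMove_liftFam {Ψ : Fin n → MvPowerSeries (Fin n) k} (hΨ0 : ∀ j, constantCoeff (Ψ j) = 0)
    (hΨdet : IsUnit (Matrix.det (Matrix.of fun i j => coeff (Finsupp.single j 1) (Ψ i)))) {w : Fin n → ℕ} (hw : ∀ j, w j ≤ 1) :
    IsCountMove ((Fin.cons (X 0) (fun j => rename (Fin.succEmb n) (Ψ j)) : Fin (n + 1) → MvPowerSeries (Fin (n + 1)) k))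
      (Fin.cons 1 w : Fin (n + 1) → ℕ) := by
  refine ⟨constantCoeff_liftFam hΨ0, by rw [det_liftFam]; exact hΨdet, fun l => ?_, ⟨0, by rw [Fin.cons_zero]; exact Nat.one_pos⟩⟩
  refine Fin.cases ?_ (fun j => ?_) l
  · rw [Fin.cons_zero]
  · rw [Fin.cons_succ]; exact hw j

/-- **The lifted move `Φ ; Λ(Ψ)` is a count move.** -/
theorem isCountMove_liftMove {Φ : Fin (n + 1) → MvPowerSeries (Fin (n + 1)) k} (hΦ0 : ∀ l, constantCoeff (Φ l) = 0)
    (hΦdet : IsUnit (Matrix.det (Matrix.of fun i j => coeff (Finsupp.single j 1) (Φ i))))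
    {Ψ : Fin n → MvPowerSeries (Fin n) k} (hΨ0 : ∀ j, constantCoeff (Ψ j) = 0)
    (hΨdet : IsUnit (Matrix.det (Matrix.of fun i j => coeff (Finsupp.single j 1) (Ψ i)))) {w : Fin n → ℕ} (hw : ∀ j, w j ≤ 1) :
    IsCountMove (fun l => subst ((Fin.cons (X 0) (fun j => rename (Fin.succEmb n) (Ψ j)) : Fin (n + 1) → MvPowerSeries (Fin (n + 1)) k)) (Φ l))
      (Fin.cons 1 w : Fin (n + 1) → ℕ) :=
  isCountMove_comp hΦ0 hΦdet (isCountMove_liftFam hΨ0 hΨdet hw)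

/-! ## Chart compatibility: the four-variable chart on renamed series is the renamed three-variable chart -/

/-- The chart convention for the lifted weights and point. -/
theorem chartConv_cons {w : Fin n → ℕ} {c : Fin n → k} (hc : ∀ j, w j = 0 → c j = 0) (c₀ : k) (l : Fin (n + 1)) :
    (Fin.cons 1 w : Fin (n + 1) → ℕ) l = 0 → (Fin.cons c₀ c : Fin (n + 1) → k) l = 0 := by
  refine Fin.cases (fun h => ?_) (fun j h => ?_) l
  · rw [Fin.cons_zero] at h; exact absurd h one_ne_zero
  · rw [Fin.cons_succ] at h ⊢; exact hc j h

/-- The chart at the slot `0` of the lifted weights: `x₀ = s · (c₀ + y₀)`. -/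
theorem chart_cons_zero (w : Fin n → ℕ) (c₀ : k) (c : Fin n → k) :
    CobordantChart.chart (Fin.cons 1 w : Fin (n + 1) → ℕ) (Fin.cons c₀ c : Fin (n + 1) → k) 0 = X 0 * (C c₀ + X 1) := by
  rw [CobordantChart.chart_apply, Fin.cons_zero, Fin.cons_zero, pow_one, Fin.succ_zero_eq_one]

/-- The chart at a slot `j + 1` of the lifted weights is the renamed three-variable chart at `j`. -/
theorem chart_cons_succ (w : Fin n → ℕ) (c₀ : k) (c : Fin n → k) (j : Fin n) :
    CobordantChart.chart (Fin.cons 1 w : Fin (n + 1) → ℕ) (Fin.cons c₀ c : Fin (n + 1) → k) j.succ =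
      rename (Fin.succAboveEmb (1 : Fin (n + 2))) (CobordantChart.chart w c j) := by
  rw [CobordantChart.chart_apply, CobordantChart.chart_apply, Fin.cons_succ, Fin.cons_succ, map_mul, map_pow, map_add, rename_C,
    rename_X, rename_X, Fin.succAboveEmb_apply, Fin.succAboveEmb_apply, Fin.succAbove_ne_zero_zero one_ne_zero, Fin.one_succAbove_succ]

/-- **CHART COMPATIBILITY**: `(rename succ F)∘chart_{(1,w),(c₀,c)} = rename (succAbove 1) (F∘chart_{w,c})`. -/
theorem subst_chart_rename_succ {w : Fin n → ℕ} {c : Fin n → k} (hc : ∀ j, w j = 0 → c j = 0) (c₀ : k) (F : MvPowerSeries (Fin n) k) :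
    subst (CobordantChart.chart (Fin.cons 1 w : Fin (n + 1) → ℕ) (Fin.cons c₀ c : Fin (n + 1) → k)) (rename (Fin.succEmb n) F) =
      rename (Fin.succAboveEmb (1 : Fin (n + 2))) (subst (CobordantChart.chart w c) F) := by
  rw [subst_rename _ (CobordantChart.hasSubst_chart _ _ (chartConv_cons hc c₀)), rename_subst _ (CobordantChart.hasSubst_chart w c hc)]
  congr 1
  funext j
  rw [Function.comp_apply, Fin.coe_succEmb, chart_cons_succ]

/-! ## Slice compatibility -/

/-- `predAbove a (succ t) ≠ 0` for `t ≠ a`. -/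
theorem predAbove_succ_ne_zero {a t : Fin (n + 1)} (h : t ≠ a) : Fin.predAbove a t.succ ≠ 0 := by
  intro h0
  have hv := congrArg Fin.val h0
  by_cases hlt : Fin.castSucc a < t.succ
  · rw [Fin.predAbove_of_castSucc_lt _ _ hlt, Fin.val_pred, Fin.val_succ, Fin.val_zero] at hv
    rw [Fin.lt_def, Fin.val_castSucc, Fin.val_succ] at hlt
    exact h (Fin.ext (by omega))
  · rw [Fin.predAbove_of_le_castSucc _ _ (not_lt.mp hlt), Fin.coe_castPred, Fin.val_succ, Fin.val_zero] at hv
    omega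

/-- **SLICE COMPATIBILITY**: slicing the renamed series at the slot `i + 1` is the renamed slice at `i`. -/
theorem slice_succ_rename (i : Fin (n + 1)) (G : MvPowerSeries (Fin (n + 2)) k) :
    TupleGame.slice i.succ (rename (Fin.succAboveEmb (1 : Fin (n + 3))) G) =
      rename (Fin.succAboveEmb (1 : Fin (n + 2))) (TupleGame.slice i G) := by
  unfold TupleGame.slice
  rw [subst_rename _ (CobordantChartPlaneSlice.hasSubst_slice (R := k) i.succ), rename_subst _ (CobordantChartPlaneSlice.hasSubst_slice (R := k) i)]
  congr 1
  funext j
  rw [Function.comp_apply, Fin.succAboveEmb_apply]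
  refine Fin.cases ?_ (fun t => ?_) j
  · rw [Fin.succAbove_ne_zero_zero one_ne_zero, if_neg (Fin.succ_ne_zero _).symm, if_neg (Fin.succ_ne_zero _).symm,
      Fin.predAbove_right_zero, Fin.predAbove_right_zero, rename_X, Fin.succAboveEmb_apply, Fin.succAbove_ne_zero_zero one_ne_zero]
  · rw [Fin.one_succAbove_succ]
    by_cases ht : t = i
    · subst ht
      rw [if_pos rfl, if_pos rfl, map_zero]
    · have hp : Fin.predAbove i t.succ ≠ 0 := predAbove_succ_ne_zero ht
      have h1 : (1 : Fin (n + 2)) ≤ Fin.castSucc (Fin.predAbove i t.succ) := by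
        rw [Fin.le_def, Fin.val_one, Fin.val_castSucc]
        exact Nat.one_le_iff_ne_zero.mpr fun h => hp (Fin.ext (by rw [h, Fin.val_zero]))
      rw [if_neg (fun h => ht (Fin.succ_injective _ (Fin.succ_injective _ h))), if_neg (fun h => ht (Fin.succ_injective _ h)), rename_X,
        Fin.succAboveEmb_apply, Fin.succ_predAbove_succ, Fin.succAbove_of_le_castSucc _ _ h1]

end LiftFam

end PairLift

end TameFourTupleDrop

end Summit.ResolutionOfSingularities.ResolutionOfSingularities.Theorems

end
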